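import Literature.NumberTheory.EllipticCurves.LatticeInclusionRigidityProofs
import Literature.NumberTheory.EllipticCurves.ModularCurveKleinJ
import Mathlib.NumberTheory.ModularForms.CongruenceSubgroups
import HarnessLib

/-!
# Transport of level-`N` structures `(ℤτ + ℤ, ℤNτ + ℤ)` along automorphisms of `ℂ`

Topic `NumberTheory/EllipticCurves` (complex multiplication / moduli of level `Γ₀(N)`).  A point
`τ ∈ ℍ` modulo `Γ₀(N)` is the isomorphism class of the pair "elliptic curve `E_τ = ℂ/Λ_τ` with the
cyclic subgroup `C_τ = ⟨1/N⟩` of order `N`" (Diamond–Shurman, *A First Course in Modular Forms*,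
Thm. 1.5.1), equivalently of the cyclic `N`-isogeny `ℂ/Λ_τ → ℂ/Λ_{Nτ}`, `z ↦ Nz`, i.e. of the
**pair of lattices** `(Λ_τ, Λ_{Nτ}) = (ℤτ + ℤ, ℤNτ + ℤ)` up to a *common* homothety.  This file
sets up, in the analytic language of the tree (`PeriodPair`, invariants `g₂, g₃`, the
Uniformization Theorem `PeriodPair.uniformization_holds` / `uniformization_unique_holds`, and the
transport of lattice inclusions `PeriodPair.lattice_le_of_le_map`), the action of an abstract field
automorphism `σ ∈ Aut(ℂ)` on such pairs — the bookkeeping behind "`σ` acts on the moduli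
`(E, C) ↦ (E^σ, C^σ)`" in the proofs of the complex-multiplication theorems for `X₀(N)`
(Shimura, *Introduction to the arithmetic theory of automorphic functions*, §6.8; Lang, *Elliptic
Functions*, Ch. 10 §1 and Ch. 11; Darmon, *Rational points on modular elliptic curves*, Thm. 3.7):

* `PeriodPair.IsTransportedBy σ L M` — `M` is *the* lattice with invariants `σ(g₂(L)), σ(g₃(L))`
  (it exists, `exists_isTransportedBy`, and its lattice is unique, `IsTransportedBy.lattice_eq`);
  API: homotheties (`(cL)^σ = σ(c)L^σ`), inclusions and multipliers are transported
  (`IsTransportedBy.le`, `IsTransportedBy.mul_mem`), `j(L^σ) = σ(j(L))`, inverse automorphism.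
* `levelPoint N τ = Nτ ∈ ℍ` and `LevelTransport N σ τ τ'` — **`σ` carries the level-`N` structure of
  `τ` to that of `τ'`**: for one `μ ≠ 0`, `σ(g_k(Λ_τ)) = μ^{2k} g_k(Λ_{τ'})` and
  `σ(g_k(Λ_{Nτ})) = μ^{2k} g_k(Λ_{Nτ'})` (`k = 2, 3`), i.e. `Λ_τ^σ = μ⁻¹Λ_{τ'}` and
  `Λ_{Nτ}^σ = μ⁻¹Λ_{Nτ'}` (`levelTransport_of_isTransportedBy`, `LevelTransport.exists_lattice_eq`).
* `Γ₀(N)` **is exactly the stabiliser of the pair up to common homothety**: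
  `exists_lattice_pair_eq_of_gamma0` (`Λ_{γτ} = kΛ_τ`, `Λ_{Nγτ} = kΛ_{Nτ}`, `k = (cτ + d)⁻¹`) and
  `exists_gamma0_smul_eq_of_lattice_pair_eq` (the converse), refining the tree's level-one
  statements `PeriodPair.exists_ofUpperHalfPlane_smul_lattice_eq`,
  `exists_sl2z_smul_eq_of_lattice_eq` (Diamond–Shurman Thm. 1.5.1; Serre, *A Course in
  Arithmetic*, VII §2.2).
* Consequences for `LevelTransport`: invariance under `Γ₀(N)` on both sides, symmetry
  `σ ↦ σ⁻¹`, and **functoriality** — two targets (or two sources) of the same `σ` are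
  `Γ₀(N)`-equivalent (`LevelTransport.exists_gamma0_smul_eq_right/left`), so `σ` induces a
  well-defined injective map on `Γ₀(N)`-orbits wherever it is defined.

Everything here is proved; there are no named facts.  The two definitions carry explicit binders
(they are relations, not statements).  This is the lattice-theoretic layer of the tree's treatment
of Shimura reciprocity for Heegner points on `X₀(N)` (sequel: `HeegnerPointsLevelTransport.lean`).

## References

* F. Diamond, J. Shurman, *A First Course in Modular Forms*, GTM 228, Springer 2005, §1.5,
  Thm. 1.5.1 (moduli interpretation of `Y₀(N)`). [DiamondShurman2005]
* G. Shimura, *Introduction to the arithmetic theory of automorphic functions*, Princeton 1971,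
  §4.2, §6.8. [ShimuraIATAF1971]
* J.-P. Serre, *A Course in Arithmetic*, GTM 7, Springer 1973, VII §2.2 (lattices and `SL₂(ℤ)`).
  [Serre1973]
* H. Darmon, *Rational points on modular elliptic curves*, CBMS 101, AMS 2004, §3.2 and Thm. 3.7.
  [Darmon2004]
-/

noncomputable section

open Complex UpperHalfPlane CongruenceSubgroup
open scoped MatrixGroups

namespace PeriodPair

/-! ### Transport of a lattice along an automorphism of `ℂ` -/

/-- `IsTransportedBy σ L M`: the lattice (period pair) `M` is the transport of `L` along the field
automorphism `σ` of `ℂ`, i.e. its Weierstrass invariants are `g₂(M) = σ(g₂(L))`,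
`g₃(M) = σ(g₃(L))` — the lattice uniformising the conjugate curve `E_L^σ : y² = 4x³ − σ(g₂)x − σ(g₃)`
(Cox, *Primes of the form x² + ny²*, proof of Thm. 10.23, choice of `L` for `σ(g₂), σ(g₃)`;
Silverman AEC VI.5.1). A deliberate dot-notation extension of Mathlib's `PeriodPair` namespace, as
the sibling files `RealLatticePeriod.lean`, `LatticeInclusionRigidityProofs.lean`. [folklore] -/
def IsTransportedBy (σ : ℂ ≃+* ℂ) (L M : PeriodPair) : Prop :=
  M.g₂ = σ L.g₂ ∧ M.g₃ = σ L.g₃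

variable {σ : ℂ ≃+* ℂ} {L L₁ L₂ M M' M₁ M₂ : PeriodPair}

/-- The discriminant `g₂³ − 27g₃²` stays non-zero under `σ`. [folklore] -/
lemma map_discr_ne_zero (σ : ℂ ≃+* ℂ) (L : PeriodPair) : (σ L.g₂) ^ 3 - 27 * (σ L.g₃) ^ 2 ≠ 0 := by
  intro h
  apply L.discr_ne_zero
  have h' : σ (L.g₂ ^ 3 - 27 * L.g₃ ^ 2) = 0 := by
    rw [map_sub, map_pow, map_mul, map_pow, map_ofNat]; exact h
  exact σ.injective (h'.trans (map_zero σ).symm)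

/-- **The transported lattice exists** (Uniformization Theorem, existence half, the tree's
`uniformization_holds`, applied to the invariants `σ(g₂), σ(g₃)`). [folklore] -/
theorem exists_isTransportedBy (σ : ℂ ≃+* ℂ) (L : PeriodPair) : ∃ M, IsTransportedBy σ L M := by
  obtain ⟨M, h₂, h₃⟩ := uniformization_holds _ _ (map_discr_ne_zero σ L)
  exact ⟨M, h₂, h₃⟩

/-- **The transported lattice is unique** as a lattice (Uniformization Theorem, uniqueness half,
`uniformization_unique_holds`). [folklore] -/
theorem IsTransportedBy.lattice_eq (h : IsTransportedBy σ L M) (h' : IsTransportedBy σ L M') :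
    M.lattice = M'.lattice :=
  uniformization_unique_holds M M' (h.1.trans h'.1.symm) (h.2.trans h'.2.symm)

/-- Transport only depends on the lattice of the source. [folklore] -/
theorem IsTransportedBy.of_lattice_eq (h : IsTransportedBy σ L₁ M) (hL : L₁.lattice = L₂.lattice) :
    IsTransportedBy σ L₂ M :=
  ⟨h.1.trans (by rw [g₂_eq_of_lattice_eq hL]), h.2.trans (by rw [g₃_eq_of_lattice_eq hL])⟩

/-- Transport only depends on the lattice of the target. [folklore] -/
theorem IsTransportedBy.of_lattice_eq_right (h : IsTransportedBy σ L M₁)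
    (hM : M₁.lattice = M₂.lattice) : IsTransportedBy σ L M₂ :=
  ⟨(g₂_eq_of_lattice_eq hM).symm.trans h.1, (g₃_eq_of_lattice_eq hM).symm.trans h.2⟩

/-- **Homotheties are transported**: if `M = L^σ` then `σ(c)M = (cL)^σ`
(`g_k(cΛ) = c^{−2k} g_k(Λ)`). [folklore] -/
theorem IsTransportedBy.mulLeft (h : IsTransportedBy σ L M) (c : ℂ) (hc : c ≠ 0) :
    IsTransportedBy σ (L.mulLeft c hc) (M.mulLeft (σ c) (σ.map_ne_zero_iff.mpr hc)) := by
  refine ⟨?_, ?_⟩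
  · rw [g₂_mulLeft, g₂_mulLeft, h.1, map_mul, map_inv₀, map_pow]
  · rw [g₃_mulLeft, g₃_mulLeft, h.2, map_mul, map_inv₀, map_pow]

/-- Transport along `σ⁻¹` undoes transport along `σ`. [folklore] -/
theorem IsTransportedBy.symm (h : IsTransportedBy σ L M) : IsTransportedBy σ.symm M L :=
  ⟨by rw [h.1, RingEquiv.symm_apply_apply], by rw [h.2, RingEquiv.symm_apply_apply]⟩

/-- `j(L^σ) = σ(j(L))`. [folklore] -/
theorem IsTransportedBy.j_eq (h : IsTransportedBy σ L M) : M.j = σ L.j := by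
  rw [j_def, j_def, h.1, h.2]
  simp only [map_div₀, map_mul, map_pow, map_sub, map_ofNat]

/-- **Inclusions are transported** (the tree's `lattice_le_of_le_map`: the algebraic certificate of
`Λ₁ ⊆ Λ₂` is a polynomial identity in `g₂, g₃` and is mapped by `σ`). [folklore] -/
theorem IsTransportedBy.le (h₁ : IsTransportedBy σ L₁ M₁) (h₂ : IsTransportedBy σ L₂ M₂)
    (h : L₁.lattice ≤ L₂.lattice) : M₁.lattice ≤ M₂.lattice :=
  lattice_le_of_le_map σ h h₁.1 h₁.2 h₂.1 h₂.2

/-- **Multipliers are transported**: if `cΛ₁ ⊆ Λ₂` then `σ(c)Λ₁^σ ⊆ Λ₂^σ` (the two-lattice form of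
Cox (10.25), "`℘(z; L)` has complex multiplication by `σ(α)`"; here from the transport of the
inclusion `Λ₁ ⊆ c⁻¹Λ₂`). [cite: Cox2013, §10.C proof of Thm. 10.23, (10.25)] -/
theorem IsTransportedBy.mul_mem (h₁ : IsTransportedBy σ L₁ M₁) (h₂ : IsTransportedBy σ L₂ M₂)
    {c : ℂ} (h : ∀ l ∈ L₁.lattice, c * l ∈ L₂.lattice) :
    ∀ m ∈ M₁.lattice, σ c * m ∈ M₂.lattice := by
  intro m hm
  rcases eq_or_ne c 0 with rfl | hc
  · rw [map_zero, zero_mul]; exact zero_mem _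
  have hle : L₁.lattice ≤ (L₂.mulLeft c⁻¹ (inv_ne_zero hc)).lattice := fun l hl ↦ by
    rw [mem_mulLeft_lattice, inv_inv]; exact h l hl
  have hle' := h₁.le (h₂.mulLeft c⁻¹ (inv_ne_zero hc)) hle hm
  rwa [mem_mulLeft_lattice, map_inv₀, inv_inv] at hle'

/-! ### The point `Nτ` and the pair `(Λ_τ, Λ_{Nτ})` -/

end PeriodPair

namespace Literature.NumberTheory.EllipticCurves

open PeriodPair Literature.NumberTheory.EllipticCurves.ModularForms

section Level

variable (N : ℕ) [NeZero N]

/-- The point `Nτ ∈ ℍ`; the lattice `Λ_{Nτ} = ℤNτ + ℤ` is `N` times the lattice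
`Λ_τ + ℤ(1/N)` generated by `Λ_τ` and the level structure `C_τ = ⟨1/N⟩` (Diamond–Shurman §1.5).
[folklore] -/
def levelPoint (τ : ℍ) : ℍ :=
  ⟨(N : ℂ) * τ, by
    rw [mul_im, natCast_re, natCast_im, zero_mul, add_zero]
    exact mul_pos (Nat.cast_pos.mpr (NeZero.pos N)) τ.im_pos⟩

variable {N}

/-- `levelPoint N τ = Nτ` as a complex number. [folklore] -/
@[simp] theorem coe_levelPoint (τ : ℍ) : ((levelPoint N τ : ℍ) : ℂ) = (N : ℂ) * τ := rfl

/-- `Λ_{Nτ} ⊆ Λ_τ`. [folklore] -/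
theorem lattice_levelPoint_le (τ : ℍ) :
    (ofUpperHalfPlane (levelPoint N τ)).lattice ≤ (ofUpperHalfPlane τ).lattice := by
  intro x hx
  obtain ⟨m, n, rfl⟩ := mem_lattice.mp hx
  refine mem_lattice.mpr ⟨m * N, n, ?_⟩
  simp only [ofUpperHalfPlane_ω₁, ofUpperHalfPlane_ω₂, coe_levelPoint]
  push_cast
  ring

/-- `NΛ_τ ⊆ Λ_{Nτ}`. [folklore] -/
theorem natCast_mul_mem_lattice_levelPoint (τ : ℍ) :
    ∀ x ∈ (ofUpperHalfPlane τ).lattice, (N : ℂ) * x ∈ (ofUpperHalfPlane (levelPoint N τ)).lattice := by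
  intro x hx
  obtain ⟨m, n, rfl⟩ := mem_lattice.mp hx
  refine mem_lattice.mpr ⟨m, n * N, ?_⟩
  simp only [ofUpperHalfPlane_ω₁, ofUpperHalfPlane_ω₂, coe_levelPoint]
  push_cast
  ring

variable (N)

/-! ### The level-`N` transport relation -/

/-- **`σ` transports the level-`N` structure of `τ` to that of `τ'`**: there is `μ ≠ 0` with
`σ(g_k(Λ_τ)) = μ^{2k} g_k(Λ_{τ'})` and `σ(g_k(Λ_{Nτ})) = μ^{2k} g_k(Λ_{Nτ'})` for `k = 2, 3`
(`Λ_τ = ℤτ + ℤ`); equivalently `Λ_τ^σ = μ⁻¹Λ_{τ'}` and `Λ_{Nτ}^σ = μ⁻¹Λ_{Nτ'}` for the transported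
lattices (`LevelTransport.exists_lattice_eq`, `levelTransport_of_isTransportedBy`), i.e. the
conjugate `(E_τ, C_τ)^σ` of the pair "curve `y² = 4x³ − g₂(τ)x − g₃(τ)`, cyclic subgroup
`⟨1/N⟩`" is isomorphic to `(E_{τ'}, C_{τ'})`, the isomorphism being `(x, y) ↦ (μ⁻²x, μ⁻³y)`
(Shimura §6.8; Diamond–Shurman Thm. 1.5.1). A relation with explicit binders (not a statement).
[folklore] -/
def LevelTransport (σ : ℂ ≃+* ℂ) (τ τ' : ℍ) : Prop :=
  ∃ μ : ℂ, μ ≠ 0 ∧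
    σ (ofUpperHalfPlane τ).g₂ = μ ^ 4 * (ofUpperHalfPlane τ').g₂ ∧
    σ (ofUpperHalfPlane τ).g₃ = μ ^ 6 * (ofUpperHalfPlane τ').g₃ ∧
    σ (ofUpperHalfPlane (levelPoint N τ)).g₂ = μ ^ 4 * (ofUpperHalfPlane (levelPoint N τ')).g₂ ∧
    σ (ofUpperHalfPlane (levelPoint N τ)).g₃ = μ ^ 6 * (ofUpperHalfPlane (levelPoint N τ')).g₃

variable {N}

/-- A lattice with invariants `g₂(M) = c⁻⁴g₂(L')`, `g₃(M) = c⁻⁶g₃(L')` is `cL'` (uniqueness of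
uniformisation, `uniformization_unique_holds`, and `g_k(cΛ) = c^{−2k}g_k(Λ)`). [folklore] -/
theorem lattice_eq_mulLeft_of_g₂_g₃ {M L' : PeriodPair} {c : ℂ} (hc : c ≠ 0)
    (h₂ : M.g₂ = (c ^ 4)⁻¹ * L'.g₂) (h₃ : M.g₃ = (c ^ 6)⁻¹ * L'.g₃) :
    M.lattice = (L'.mulLeft c hc).lattice :=
  uniformization_unique_holds _ _ (by rw [g₂_mulLeft, h₂]) (by rw [g₃_mulLeft, h₃])

/-- **From transported lattices to `LevelTransport`**: if `Λ_τ^σ = cΛ_{τ'}` and `Λ_{Nτ}^σ = cΛ_{Nτ'}`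
for one `c ≠ 0`, then `σ` transports the level-`N` structure of `τ` to that of `τ'` (`μ = c⁻¹`).
[folklore] -/
theorem levelTransport_of_isTransportedBy {σ : ℂ ≃+* ℂ} {τ τ' : ℍ} {M M_N : PeriodPair}
    (hM : IsTransportedBy σ (ofUpperHalfPlane τ) M)
    (hMN : IsTransportedBy σ (ofUpperHalfPlane (levelPoint N τ)) M_N) {c : ℂ} (hc : c ≠ 0)
    (h : M.lattice = ((ofUpperHalfPlane τ').mulLeft c hc).lattice)
    (hN : M_N.lattice = ((ofUpperHalfPlane (levelPoint N τ')).mulLeft c hc).lattice) :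
    LevelTransport N σ τ τ' := by
  refine ⟨c⁻¹, inv_ne_zero hc, ?_, ?_, ?_, ?_⟩
  · rw [← hM.1, g₂_eq_of_lattice_eq h, g₂_mulLeft, inv_pow]
  · rw [← hM.2, g₃_eq_of_lattice_eq h, g₃_mulLeft, inv_pow]
  · rw [← hMN.1, g₂_eq_of_lattice_eq hN, g₂_mulLeft, inv_pow]
  · rw [← hMN.2, g₃_eq_of_lattice_eq hN, g₃_mulLeft, inv_pow]

/-- **From `LevelTransport` to transported lattices**: the transports of `Λ_τ` and `Λ_{Nτ}` along `σ`
are `cΛ_{τ'}` and `cΛ_{Nτ'}` for one and the same `c ≠ 0`. [folklore] -/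
theorem LevelTransport.exists_lattice_eq {σ : ℂ ≃+* ℂ} {τ τ' : ℍ} (h : LevelTransport N σ τ τ')
    {M M_N : PeriodPair} (hM : IsTransportedBy σ (ofUpperHalfPlane τ) M)
    (hMN : IsTransportedBy σ (ofUpperHalfPlane (levelPoint N τ)) M_N) :
    ∃ (c : ℂ) (hc : c ≠ 0), M.lattice = ((ofUpperHalfPlane τ').mulLeft c hc).lattice ∧
      M_N.lattice = ((ofUpperHalfPlane (levelPoint N τ')).mulLeft c hc).lattice := by
  obtain ⟨μ, hμ, h₂, h₃, h₂', h₃'⟩ := h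
  refine ⟨μ⁻¹, inv_ne_zero hμ, lattice_eq_mulLeft_of_g₂_g₃ _ ?_ ?_,
    lattice_eq_mulLeft_of_g₂_g₃ _ ?_ ?_⟩
  · rw [hM.1, h₂, inv_pow, inv_inv]
  · rw [hM.2, h₃, inv_pow, inv_inv]
  · rw [hMN.1, h₂', inv_pow, inv_inv]
  · rw [hMN.2, h₃', inv_pow, inv_inv]

/-! ### `Γ₀(N)` and common homotheties of the pair `(Λ_τ, Λ_{Nτ})` -/

/-- `(cτ + d)⁻¹ ≠ 0` for `γ = (a b; c d) ∈ SL₂(ℤ)` and `τ ∈ ℍ` — the homothety factor of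
`Λ_{γτ} = (cτ + d)⁻¹Λ_τ` (Mathlib `UpperHalfPlane.denom_ne_zero`, `ModularGroup.denom_apply`).
[folklore] -/
theorem inv_sl2z_denom_ne_zero (γ : SL(2, ℤ)) (τ : ℍ) : ((γ 1 0 : ℂ) * τ + γ 1 1)⁻¹ ≠ 0 := by
  refine inv_ne_zero ?_
  have h := UpperHalfPlane.denom_ne_zero (γ : GL (Fin 2) ℝ) τ
  rwa [ModularGroup.denom_apply] at h

/-- **`SL₂(ℤ)` acts on the lattices `Λ_τ` by the explicit homothety `(cτ + d)⁻¹`**: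
`Λ_{γτ} = (cτ + d)⁻¹Λ_τ` for `γ = (a b; c d)` (the tree's
`PeriodPair.exists_ofUpperHalfPlane_smul_lattice_eq` with the factor made explicit; Serre VII §2.2;
Cox (7.8)). [folklore] -/
theorem ofUpperHalfPlane_smul_lattice_eq (γ : SL(2, ℤ)) (τ : ℍ) :
    (ofUpperHalfPlane (γ • τ)).lattice =
      ((ofUpperHalfPlane τ).mulLeft ((γ 1 0 : ℂ) * τ + γ 1 1)⁻¹
        (inv_sl2z_denom_ne_zero γ τ)).lattice := by
  have hdet : (γ 0 0 : ℂ) * γ 1 1 - γ 0 1 * γ 1 0 = 1 := by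
    have h := Matrix.SpecialLinearGroup.det_coe γ
    rw [Matrix.det_fin_two] at h
    exact_mod_cast h
  have hcd : (γ 1 0 : ℂ) * τ + γ 1 1 ≠ 0 := fun h ↦ inv_sl2z_denom_ne_zero γ τ (inv_eq_zero.mpr h)
  have hcoe : ((γ • τ : ℍ) : ℂ) = ((γ 0 0 : ℂ) * τ + γ 0 1) / ((γ 1 0 : ℂ) * τ + γ 1 1) := by
    rw [UpperHalfPlane.coe_specialLinearGroup_apply]
    simp only [algebraMap_int_eq, Int.coe_castRingHom, ofReal_intCast]
  ext x
  rw [mem_lattice, mem_mulLeft_lattice, inv_inv, mem_lattice]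
  simp only [ofUpperHalfPlane_ω₁, ofUpperHalfPlane_ω₂, mul_one, hcoe]
  constructor
  · rintro ⟨m, n, rfl⟩
    refine ⟨m * γ 0 0 + n * γ 1 0, m * γ 0 1 + n * γ 1 1, ?_⟩
    push_cast
    field_simp
    ring
  · rintro ⟨m, n, hmn⟩
    refine ⟨m * γ 1 1 - n * γ 1 0, -(m * γ 0 1) + n * γ 0 0, ?_⟩
    have hx : x = ((m : ℂ) * τ + n) / ((γ 1 0 : ℂ) * τ + γ 1 1) := by
      rw [eq_div_iff hcd, mul_comm]; exact hmn.symm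
    rw [hx]
    push_cast
    field_simp
    linear_combination ((m : ℂ) * (τ : ℂ) + n) * hdet

/-- For `γ = (a b; c d) ∈ Γ₀(N)`, the matrix `γ' = (a, bN; c/N, d) ∈ SL₂(ℤ)` satisfies
`N(γτ) = γ'(Nτ)`. [folklore] -/
theorem levelPoint_gamma0_smul (γ : Gamma0 N) (τ : ℍ) :
    ∃ γ' : SL(2, ℤ), γ' 1 0 * N = (γ : SL(2, ℤ)) 1 0 ∧ γ' 1 1 = (γ : SL(2, ℤ)) 1 1 ∧
      levelPoint N ((γ : SL(2, ℤ)) • τ) = γ' • levelPoint N τ := by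
  set g : SL(2, ℤ) := ↑γ with hg
  have hN0 : (N : ℤ) ≠ 0 := by exact_mod_cast NeZero.ne N
  have hdvd : (N : ℤ) ∣ g 1 0 := by
    have h := Gamma0_mem.mp γ.2
    rw [← hg] at h
    exact (ZMod.intCast_zmod_eq_zero_iff_dvd _ _).mp h
  obtain ⟨c', hc'⟩ := hdvd
  have hdet : g 0 0 * g 1 1 - g 0 1 * g 1 0 = 1 := by
    have h := Matrix.SpecialLinearGroup.det_coe g
    rw [Matrix.det_fin_two] at h
    linarith
  have hdet' : g 0 0 * g 1 1 - (g 0 1 * N) * c' = 1 := by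
    linear_combination hdet + (g 0 1) * hc'
  refine ⟨sl2zMk (g 0 0) (g 0 1 * N) c' (g 1 1) hdet', ?_, rfl, ?_⟩
  · show c' * N = g 1 0
    rw [hc', mul_comm]
  · apply UpperHalfPlane.ext
    have hcd : (g 1 0 : ℂ) * τ + g 1 1 ≠ 0 := fun h ↦ inv_sl2z_denom_ne_zero g τ (inv_eq_zero.mpr h)
    have hcoe : ((g • τ : ℍ) : ℂ) = ((g 0 0 : ℂ) * τ + g 0 1) / ((g 1 0 : ℂ) * τ + g 1 1) := by
      rw [UpperHalfPlane.coe_specialLinearGroup_apply]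
      simp only [algebraMap_int_eq, Int.coe_castRingHom, ofReal_intCast]
    have hc'C : (g 1 0 : ℂ) = (N : ℂ) * c' := by exact_mod_cast hc'
    rw [coe_levelPoint, coe_sl2zMk_smul, coe_levelPoint, hcoe, hc'C]
    have hden : (c' : ℂ) * ((N : ℂ) * τ) + g 1 1 ≠ 0 := by
      rw [hc'C] at hcd
      convert hcd using 1; ring
    rw [mul_div_assoc', div_eq_div_iff (by rw [hc'C] at hcd; exact hcd) hden]
    push_cast
    ring

/-- **`Γ₀(N)` acts on the pairs `(Λ_τ, Λ_{Nτ})` by common homotheties**: for `γ = (a b; c d) ∈ Γ₀(N)`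
and `k = (cτ + d)⁻¹`, `Λ_{γτ} = kΛ_τ` and `Λ_{Nγτ} = kΛ_{Nτ}` (because `N(γτ) = γ'(Nτ)` with
`γ' = (a, bN; c/N, d)` of the same denominator). (Diamond–Shurman §1.5.) [folklore] -/
theorem exists_lattice_pair_eq_of_gamma0 (γ : Gamma0 N) (τ : ℍ) :
    ∃ (k : ℂ) (hk : k ≠ 0),
      (ofUpperHalfPlane ((γ : SL(2, ℤ)) • τ)).lattice = ((ofUpperHalfPlane τ).mulLeft k hk).lattice ∧
      (ofUpperHalfPlane (levelPoint N ((γ : SL(2, ℤ)) • τ))).lattice =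
        ((ofUpperHalfPlane (levelPoint N τ)).mulLeft k hk).lattice := by
  obtain ⟨γ', h10, h11, hγ'⟩ := levelPoint_gamma0_smul γ τ
  refine ⟨_, inv_sl2z_denom_ne_zero (γ : SL(2, ℤ)) τ, ofUpperHalfPlane_smul_lattice_eq _ τ, ?_⟩
  rw [hγ', ofUpperHalfPlane_smul_lattice_eq γ' (levelPoint N τ)]
  congr 2
  rw [coe_levelPoint, ← h10, ← h11]
  push_cast
  ring

/-- **Common homotheties of the pair come from `Γ₀(N)`**: if `Λ_{τ₂} = cΛ_{τ₁}` and
`Λ_{Nτ₂} = cΛ_{Nτ₁}` with the same `c`, then `τ₂ = γτ₁` for some `γ ∈ Γ₀(N)` — the level-one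
statement (`exists_sl2z_smul_eq_of_lattice_eq`: `γ = (a b; c' d)` with `1 = c(c'τ₁ + d)`) plus
`1 ∈ cΛ_{Nτ₁}`, which forces `N ∣ c'` (Diamond–Shurman Thm. 1.5.1: pairs `(E, C)` up to isomorphism
are `Γ₀(N)`-orbits). [cite: DiamondShurman2005, Thm. 1.5.1] -/
theorem exists_gamma0_smul_eq_of_lattice_pair_eq {τ₁ τ₂ : ℍ} {c : ℂ} (hc : c ≠ 0)
    (h : (ofUpperHalfPlane τ₂).lattice = ((ofUpperHalfPlane τ₁).mulLeft c hc).lattice)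
    (hN : (ofUpperHalfPlane (levelPoint N τ₂)).lattice =
      ((ofUpperHalfPlane (levelPoint N τ₁)).mulLeft c hc).lattice) :
    ∃ γ : Gamma0 N, (γ : SL(2, ℤ)) • τ₁ = τ₂ := by
  set L₁ := ofUpperHalfPlane τ₁ with hL₁
  set L₂ := ofUpperHalfPlane τ₂ with hL₂
  have hτ₂ : (τ₂ : ℂ) ∈ (L₁.mulLeft c hc).lattice := h ▸ L₂.ω₁_mem_lattice
  have h1 : (1 : ℂ) ∈ (L₁.mulLeft c hc).lattice := h ▸ L₂.ω₂_mem_lattice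
  have hcτ₁ : c * τ₁ ∈ L₂.lattice := h ▸ (L₁.mulLeft c hc).ω₁_mem_lattice
  have hc1 : c * 1 ∈ L₂.lattice := h ▸ (L₁.mulLeft c hc).ω₂_mem_lattice
  have h1N : (1 : ℂ) ∈ ((ofUpperHalfPlane (levelPoint N τ₁)).mulLeft c hc).lattice :=
    hN ▸ (ofUpperHalfPlane (levelPoint N τ₂)).ω₂_mem_lattice
  obtain ⟨a, b, hab⟩ := mem_lattice.mp hτ₂
  obtain ⟨c', d, hcd⟩ := mem_lattice.mp h1
  obtain ⟨p, q, hpq⟩ := mem_lattice.mp hcτ₁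
  obtain ⟨r, s, hrs⟩ := mem_lattice.mp hc1
  obtain ⟨r', s', hrs'⟩ := mem_lattice.mp h1N
  simp only [mulLeft_ω₁, mulLeft_ω₂, ofUpperHalfPlane_ω₁, ofUpperHalfPlane_ω₂, hL₁, hL₂,
    mul_one, coe_levelPoint] at hab hcd hpq hrs hrs'
  -- the relations `M'M = 1` for `M = (a b; c' d)`, `M' = (p q; r s)`
  have e12 : ((p * a + q * c' - 1 : ℤ) : ℂ) * τ₁ + ((p * b + q * d : ℤ) : ℂ) = 0 := by
    have : c * (((p * a + q * c' - 1 : ℤ) : ℂ) * τ₁ + ((p * b + q * d : ℤ) : ℂ)) = 0 := by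
      push_cast
      linear_combination (p : ℂ) * hab + (q : ℂ) * hcd + hpq
    simpa [hc] using this
  have e34 : ((r * a + s * c' : ℤ) : ℂ) * τ₁ + ((r * b + s * d - 1 : ℤ) : ℂ) = 0 := by
    have : c * (((r * a + s * c' : ℤ) : ℂ) * τ₁ + ((r * b + s * d - 1 : ℤ) : ℂ)) = 0 := by
      push_cast
      linear_combination (r : ℂ) * hab + (s : ℂ) * hcd + hrs
    simpa [hc] using this
  obtain ⟨e1, e2⟩ := int_mul_coe_add_eq_zero e12
  obtain ⟨e3, e4⟩ := int_mul_coe_add_eq_zero e34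
  have hdet : (p * s - q * r) * (a * d - b * c') = 1 := by
    linear_combination (r * b + s * d) * e1 - (r * a + s * c') * e2 + e4
  -- the level: `c'τ₁ + d = r'Nτ₁ + s'`, so `N ∣ c'`
  have eN : ((c' - r' * N : ℤ) : ℂ) * τ₁ + ((d - s' : ℤ) : ℂ) = 0 := by
    have : c * (((c' - r' * N : ℤ) : ℂ) * τ₁ + ((d - s' : ℤ) : ℂ)) = 0 := by
      push_cast
      linear_combination hcd - hrs'
    simpa [hc] using this
  obtain ⟨e5, -⟩ := int_mul_coe_add_eq_zero eN
  have hNc' : (N : ℤ) ∣ c' := ⟨r', by linarith⟩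
  -- `w = c'τ₁ + d ≠ 0` and `τ₂ w = aτ₁ + b`
  have hw : (c' : ℂ) * τ₁ + d ≠ 0 := by
    intro h0
    have : c * ((c' : ℂ) * τ₁ + d) = 1 := by linear_combination hcd
    rw [h0, mul_zero] at this
    exact zero_ne_one this
  have hτ₂w : (τ₂ : ℂ) * ((c' : ℂ) * τ₁ + d) = (a : ℂ) * τ₁ + b := by
    linear_combination ((a : ℂ) * τ₁ + b) * hcd - ((c' : ℂ) * τ₁ + d) * hab
  rcases Int.eq_one_or_neg_one_of_mul_eq_one (u := a * d - b * c') (v := p * s - q * r)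
      (by linear_combination hdet) with hu | hu
  · have hmem : sl2zMk a b c' d hu ∈ Gamma0 N := by
      rw [Gamma0_mem]
      show ((c' : ℤ) : ZMod N) = 0
      exact (ZMod.intCast_zmod_eq_zero_iff_dvd _ _).mpr hNc'
    refine ⟨⟨sl2zMk a b c' d hu, hmem⟩, UpperHalfPlane.ext ?_⟩
    show ((sl2zMk a b c' d hu • τ₁ : ℍ) : ℂ) = τ₂
    rw [coe_sl2zMk_smul, div_eq_iff hw, hτ₂w]
  · -- determinant `-1` is impossible: `(-a -b; c' d)` would send `τ₁` to `-τ₂ ∉ ℍ`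
    exfalso
    have hu' : (-a) * d - (-b) * c' = 1 := by linear_combination -hu
    have him := (sl2zMk (-a) (-b) c' d hu' • τ₁).im_pos
    have hcoe : ((sl2zMk (-a) (-b) c' d hu' • τ₁ : ℍ) : ℂ) = -τ₂ := by
      rw [coe_sl2zMk_smul, div_eq_iff hw]
      push_cast
      linear_combination hτ₂w
    rw [← UpperHalfPlane.coe_im, hcoe, Complex.neg_im, UpperHalfPlane.coe_im] at him
    linarith [τ₂.im_pos]

/-! ### `LevelTransport`: invariance under `Γ₀(N)`, symmetry, functoriality -/

namespace LevelTransport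

variable {σ : ℂ ≃+* ℂ} {τ τ' τ'' τ₁ τ₂ : ℍ}

/-- The target of a level-`N` transport may be moved within its `Γ₀(N)`-orbit. [folklore] -/
theorem smul_right (h : LevelTransport N σ τ τ') (γ : Gamma0 N) :
    LevelTransport N σ τ ((γ : SL(2, ℤ)) • τ') := by
  obtain ⟨μ, hμ, h₂, h₃, h₂', h₃'⟩ := h
  obtain ⟨k, hk, hL, hLN⟩ := exists_lattice_pair_eq_of_gamma0 γ τ'
  refine ⟨μ * k, mul_ne_zero hμ hk, ?_, ?_, ?_, ?_⟩
  · rw [h₂, g₂_eq_of_lattice_eq hL, g₂_mulLeft]; field_simp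
  · rw [h₃, g₃_eq_of_lattice_eq hL, g₃_mulLeft]; field_simp
  · rw [h₂', g₂_eq_of_lattice_eq hLN, g₂_mulLeft]; field_simp
  · rw [h₃', g₃_eq_of_lattice_eq hLN, g₃_mulLeft]; field_simp

/-- The source of a level-`N` transport may be moved within its `Γ₀(N)`-orbit. [folklore] -/
theorem smul_left (h : LevelTransport N σ τ τ') (γ : Gamma0 N) :
    LevelTransport N σ ((γ : SL(2, ℤ)) • τ) τ' := by
  obtain ⟨μ, hμ, h₂, h₃, h₂', h₃'⟩ := h
  obtain ⟨k, hk, hL, hLN⟩ := exists_lattice_pair_eq_of_gamma0 γ τ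
  have hσk : σ k ≠ 0 := σ.map_ne_zero_iff.mpr hk
  refine ⟨μ * (σ k)⁻¹, mul_ne_zero hμ (inv_ne_zero hσk), ?_, ?_, ?_, ?_⟩
  · rw [g₂_eq_of_lattice_eq hL, g₂_mulLeft, map_mul, map_inv₀, map_pow, h₂]; field_simp
  · rw [g₃_eq_of_lattice_eq hL, g₃_mulLeft, map_mul, map_inv₀, map_pow, h₃]; field_simp
  · rw [g₂_eq_of_lattice_eq hLN, g₂_mulLeft, map_mul, map_inv₀, map_pow, h₂']; field_simp
  · rw [g₃_eq_of_lattice_eq hLN, g₃_mulLeft, map_mul, map_inv₀, map_pow, h₃']; field_simp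

/-- `Γ₀(N)`-equivalent targets: `LevelTransport N σ τ` is constant on `Γ₀(N)`-orbits. [folklore] -/
theorem of_gamma0_smul_eq_right (h : LevelTransport N σ τ τ') {γ : Gamma0 N}
    (hγ : (γ : SL(2, ℤ)) • τ' = τ'') : LevelTransport N σ τ τ'' :=
  hγ ▸ h.smul_right γ

/-- `Γ₀(N)`-equivalent sources. [folklore] -/
theorem of_gamma0_smul_eq_left (h : LevelTransport N σ τ τ') {γ : Gamma0 N}
    (hγ : (γ : SL(2, ℤ)) • τ = τ₁) : LevelTransport N σ τ₁ τ' :=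
  hγ ▸ h.smul_left γ

/-- **Symmetry**: if `σ` carries the level structure of `τ` to that of `τ'`, then `σ⁻¹` carries
that of `τ'` back to that of `τ`. [folklore] -/
theorem symm (h : LevelTransport N σ τ τ') : LevelTransport N σ.symm τ' τ := by
  obtain ⟨μ, hμ, h₂, h₃, h₂', h₃'⟩ := h
  have hμ' : σ.symm μ ≠ 0 := σ.symm.map_ne_zero_iff.mpr hμ
  have key : ∀ {x y : ℂ} {n : ℕ}, σ x = μ ^ n * y → σ.symm y = ((σ.symm μ)⁻¹) ^ n * x := by
    intro x y n hxy
    have h := congrArg σ.symm hxy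
    rw [RingEquiv.symm_apply_apply, map_mul, map_pow] at h
    rw [h, inv_pow, ← mul_assoc, inv_mul_cancel₀ (pow_ne_zero _ hμ'), one_mul]
  exact ⟨(σ.symm μ)⁻¹, inv_ne_zero hμ', key h₂, key h₃, key h₂', key h₃'⟩

/-- **Functoriality (targets)**: two targets of the level structure of `τ` under the same `σ` are
`Γ₀(N)`-equivalent — the transported pair `(Λ_τ^σ, Λ_{Nτ}^σ)` is a common homothetic image of both
`(Λ_{τ'}, Λ_{Nτ'})` and `(Λ_{τ''}, Λ_{Nτ''})` (`exists_gamma0_smul_eq_of_lattice_pair_eq`). Hence `σ`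
induces a well-defined map on `Γ₀(N)`-orbits. [cite: DiamondShurman2005, Thm. 1.5.1] -/
theorem exists_gamma0_smul_eq_right (h : LevelTransport N σ τ τ') (h' : LevelTransport N σ τ τ'') :
    ∃ γ : Gamma0 N, (γ : SL(2, ℤ)) • τ' = τ'' := by
  obtain ⟨μ, hμ, h₂, h₃, h₂', h₃'⟩ := h
  obtain ⟨ν, hν, k₂, k₃, k₂', k₃'⟩ := h'
  have hc : ν / μ ≠ 0 := div_ne_zero hν hμ
  refine exists_gamma0_smul_eq_of_lattice_pair_eq hc
    (lattice_eq_mulLeft_of_g₂_g₃ hc ?_ ?_) (lattice_eq_mulLeft_of_g₂_g₃ hc ?_ ?_)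
  · have e := h₂.symm.trans k₂
    rw [div_pow, inv_div, div_mul_eq_mul_div, eq_div_iff (pow_ne_zero _ hν), mul_comm, ← e]
  · have e := h₃.symm.trans k₃
    rw [div_pow, inv_div, div_mul_eq_mul_div, eq_div_iff (pow_ne_zero _ hν), mul_comm, ← e]
  · have e := h₂'.symm.trans k₂'
    rw [div_pow, inv_div, div_mul_eq_mul_div, eq_div_iff (pow_ne_zero _ hν), mul_comm, ← e]
  · have e := h₃'.symm.trans k₃'
    rw [div_pow, inv_div, div_mul_eq_mul_div, eq_div_iff (pow_ne_zero _ hν), mul_comm, ← e]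

/-- **Functoriality (sources)**: two sources with the same target under `σ` are `Γ₀(N)`-equivalent
(apply the previous statement to `σ⁻¹`); hence the map induced by `σ` on `Γ₀(N)`-orbits is
injective. [cite: DiamondShurman2005, Thm. 1.5.1] -/
theorem exists_gamma0_smul_eq_left (h₁ : LevelTransport N σ τ₁ τ') (h₂ : LevelTransport N σ τ₂ τ') :
    ∃ γ : Gamma0 N, (γ : SL(2, ℤ)) • τ₁ = τ₂ :=
  h₁.symm.exists_gamma0_smul_eq_right h₂.symm

end LevelTransport

/-- The identity transports every level structure to itself (`μ = 1`). [folklore] -/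
theorem levelTransport_refl (τ : ℍ) : LevelTransport N (RingEquiv.refl ℂ) τ τ :=
  ⟨1, one_ne_zero, by simp, by simp, by simp, by simp⟩

end Level

end Literature.NumberTheory.EllipticCurves

end
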